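import Literature.NumberTheory.GaloisRepresentations.QuadraticEisensteinRamificationProofs
import Literature.NumberTheory.GaloisRepresentations.HerbrandTheorem
import Literature.NumberTheory.GaloisRepresentations.RamificationFiltrationQuotients
import HarnessLib

/-!
# The top ramification break from a distinguished wild element; the index of an involution
# (Serre, *Local Fields*, Ch. IV §§1–3)

`Proofs` file (theorems only, no definitions, no named facts) in topic
`NumberTheory/GaloisRepresentations`, sibling of `HerbrandTheorem`, `RamificationGalois` and
`QuadraticEisensteinRamificationProofs`, landed by the seat of bsd.S15
(`Literature.NumberTheory.EllipticCurves.conductorNorm_eq_artinConductorNat_of_isElliptic`) as the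
first generic brick for the **Galois side of Ogg's formula at the supersingular potentially good
places of residue characteristic `2`** of an elliptic curve (Silverman, *Advanced Topics in the
Arithmetic of Elliptic Curves*, Thm. IV.11.1, case `p = 2`, PDF p. 366 of the held copy: referred
to Saito; no printed case analysis).  There the `3`-division field `F = K(E[3])` has wild inertia
`G₁ ⊆ SL₂(𝔽₃)` a `2`-group — a subgroup of the quaternion group `Q₈` — all of whose non-trivial
elements have the central involution `ι = [-1]` as a power.  For such a filtration the whole
upper-numbering information needed for the Swan conductor is carried by the single integer
`b = i_G(ι) - 1`, and `b` is computed from the action of `ι` on one element of odd order.  This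
file proves the two group/valuation-theoretic statements behind that, in the abstract settings of
`HerbrandTheorem` (a finite group acting on `(S, 𝔓)`) and of `RamificationGalois` (a group acting
on a Dedekind domain `B` with a maximal ideal `P` of finite residue field):

* `ramificationSubgroup_ne_bot_iff_mem_of_forall_mem_zpowers` — if `ι ≠ 1` lies in `⟨σ⟩` for
  every `σ ≠ 1` of `G₁`, then for `i ≥ 1`: **`G_i ≠ 1 ↔ ι ∈ G_i`**; hence, with `i_G(ι) = b + 1`,
  `G_i ≠ 1 ↔ i ≤ b` (`ramificationSubgroup_ne_bot_iff_le_of_lowerIndex_eq`);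
* `setOf_upperRamificationSubgroup_ne_bot_eq_Ioc_herbrandPhi` — if `G_i ≠ 1 ↔ i ≤ b` for all
  `i ≥ 1`, then **`{u > 0 : G^u ≠ 1} = (0, φ(b)]`** (`G^u = G_{⌈ψ u⌉}`, `ψ = φ⁻¹` increasing), of
  Lebesgue measure `φ(b)` (`volume_real_setOf_upperRamificationSubgroup_ne_bot_eq_herbrandPhi`) —
  the many-break generalisation of `setOf_upperRamificationSubgroup_ne_bot_eq_Ioc`
  (`QuadraticEisensteinRamificationProofs`);
* `card_mul_herbrandPhi_eq_of_lowerIndex_eq` — **Serre's Lemma 3 evaluated**: if the non-trivial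
  elements of `G₀` are listed by a finset `T` with indices `i_G(s) = f(s) ≤ b + 1`, then
  `#G₀ · φ(b) = b + Σ_{s ∈ T} (f(s) - 1)` (and `#G₀ = #T + 1`); the same with the wild elements
  `G₁ ∖ 1` only (`card_mul_herbrandPhi_eq_of_lowerIndex_eq_of_wild`: tame elements have index
  `1`);
* `smul_sub_mem_pow_add_of_mem_pow` — `σ ∈ G_j`, `y ∈ P^a` ⇒ `σy - y ∈ P^{a+j}`;
* `ord_smul_sub_eq_of_lowerIndex_eq` — **the index of a wild element is read on any element of
  order prime to the residue characteristic**: for `σ ∈ G₁` with `i_G(σ) = j + 1` and `x ∈ B` with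
  `v_P(x) = n`, `n` a unit mod `P`, one has **`v_P(σx - x) = j + n`** (Serre's
  `i_G(σ) = v(σπ - π)` is the case `n = 1`; for `x = πⁿ d + (higher)`,
  `(σπ)ⁿ - πⁿ = (σπ - π) · Σ (σπ)ᵏπⁿ⁻¹⁻ᵏ` and the cofactor is `n πⁿ⁻¹ (mod Pⁿ)`);
* `ord_two_mul_eq_of_smul_eq_neg`, `lowerIndex_eq_of_smul_eq_neg` — **the index of an element
  acting as `-1` on `w`**: if `σw = -w`, `σt = t` and `v_P(w - t) = n` is a unit mod `P`
  (in residue characteristic `2`: `n` odd), then `v_P(2w) = j + n`, i.e.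
  **`i_G(σ) - 1 = v_P(2w) - v_P(w - t)`** — the break of a quadratic extension `M(w)/M`,
  `w² ∈ M`, read off an approximate square root `t ∈ M` of `w²` (the familiar
  `b = 2v(2) - (odd defect)`; cf. `ord_two_mul_root_add_eq` for the Eisenstein normal form).

How these are used (sequel files): for `F = K(E[3]) ⊇ E = K(x(E[3])) = F^ι` at a prime above
`2`, `Sw(E[3]) = 2φ_{F/K}(b) = 2φ_{E/K}(b)` (`HerbrandTheorem`, Prop. 15, `φ_{F/E} = id` on
`[0, b]`), `b = v(2w) - v(w - t)` with `w = 2y_P + a₁x_P + a₃`, and `#Q₀ · φ_{E/K}(b)` is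
evaluated by `card_mul_herbrandPhi_eq_of_lowerIndex_eq` on `Q = Gal(E/K)`, whose wild inertia is
a four-group of involutions, each index again given by `lowerIndex_eq_of_smul_eq_neg`.

## References

* J.-P. Serre, *Local Fields*, GTM 67 (1979): Ch. IV §1, pp. 61–63 (`G_i`, `i_G`, Lemma 1,
  Prop. 2), §2 Prop. 5 and Cor. 3 of Prop. 7 (`G₁` a `p`-group, `G_i/G_{i+1}` killed by `p`),
  §3 pp. 73–76 (`φ`, `ψ`, Lemma 3, upper numbering). [SerreLocalFields1979]
* J. H. Silverman, *Advanced Topics in the Arithmetic of Elliptic Curves*, GTM 151 (1994), §IV.10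
  (definition of `δ`, PDF p. 358) and Thm. IV.11.1, case `p = 2` (p. 366). [SilvermanATAEC1994]

## Design

No definitions.  §1 is stated for any finite group acting on a commutative ring (`HerbrandTheorem`
setting, `Ideal.ramificationSubgroup`, `lowerIndex`, `herbrandPhi/Psi`,
`upperRamificationSubgroup`); the inertia elements are passed as an explicit `Finset` `T` with a
membership characterisation, so that users with an explicit Galois group need no decidability or
`Fintype` bookkeeping.  §2 is stated for any group acting on a Dedekind domain with a maximal
ideal of finite residue field (`RamificationGalois` setting, `ord`, the uniformizer criterion
`mem_ramificationSubgroup_iff_smul_sub_mem` of `RamificationFiltrationQuotients`).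
`noncomputable section`; namespace `Literature.NumberTheory.GaloisRepresentations`.
Axioms: `propext`, `Classical.choice`, `Quot.sound`.
-/

noncomputable section

open scoped Pointwise
open MeasureTheory Set

namespace Literature.NumberTheory.GaloisRepresentations

/-! ### §1. The last ramification group generated by a distinguished element -/

section LastGroup

variable {S : Type*} [CommRing S] (𝔓 : Ideal S) {G : Type*} [Group G] [MulSemiringAction G S]

/-- **`G_i ≠ 1 ↔ ι ∈ G_i` (`i ≥ 1`)** when every non-trivial element of `G₁` has `ι ≠ 1` among
its powers (e.g. `G₁` cyclic or generalised quaternion of `2`-power order and `ι` its unique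
involution): a non-trivial `G_i ≤ G₁` contains some `σ ≠ 1`, hence `⟨σ⟩ ∋ ι`.
Serre, *Local Fields*, Ch. IV §1 (the `G_i` are subgroups, decreasing in `i`).
[cite: SerreLocalFields1979, Ch. IV §1 Prop. 1] -/
theorem ramificationSubgroup_ne_bot_iff_mem_of_forall_mem_zpowers {ι : G} (hι : ι ≠ 1)
    (hgen : ∀ σ ∈ 𝔓.ramificationSubgroup G 1, σ ≠ 1 → ι ∈ Subgroup.zpowers σ)
    {i : ℕ} (hi : 1 ≤ i) :
    𝔓.ramificationSubgroup G i ≠ ⊥ ↔ ι ∈ 𝔓.ramificationSubgroup G i := by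
  constructor
  · intro h
    obtain ⟨σ, hσ, hσ1⟩ : ∃ σ ∈ 𝔓.ramificationSubgroup G i, σ ≠ 1 := by
      by_contra h'
      push Not at h'
      exact h ((Subgroup.eq_bot_iff_forall _).mpr h')
    have hσ' : σ ∈ 𝔓.ramificationSubgroup G 1 := 𝔓.ramificationSubgroup_antitone G hi hσ
    exact (Subgroup.zpowers_le.mpr hσ) (hgen σ hσ' hσ1)
  · intro h hbot
    rw [hbot, Subgroup.mem_bot] at h
    exact hι h

/-- With `i_G(ι) = b + 1` in the situation of
`ramificationSubgroup_ne_bot_iff_mem_of_forall_mem_zpowers`: for `i ≥ 1`, **`G_i ≠ 1 ↔ i ≤ b`**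
(`ι ∈ G_i ↔ i + 1 ≤ i_G(ι)`).  [cite: SerreLocalFields1979, Ch. IV §1 (p. 62: i_G(s) ≥ i + 1 ⇔ s ∈ G_i)] -/
theorem ramificationSubgroup_ne_bot_iff_le_of_lowerIndex_eq {ι : G} (hι : ι ≠ 1)
    (hgen : ∀ σ ∈ 𝔓.ramificationSubgroup G 1, σ ≠ 1 → ι ∈ Subgroup.zpowers σ)
    {b : ℕ} (hb : lowerIndex 𝔓 G ι = b + 1) {i : ℕ} (hi : 1 ≤ i) :
    𝔓.ramificationSubgroup G i ≠ ⊥ ↔ i ≤ b := by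
  rw [ramificationSubgroup_ne_bot_iff_mem_of_forall_mem_zpowers 𝔓 hι hgen hi,
    ← add_one_le_lowerIndex_iff 𝔓, hb]
  have h1 : (i : ℕ∞) + 1 = ((i + 1 : ℕ) : ℕ∞) := by push_cast; rfl
  have h2 : (b : ℕ∞) + 1 = ((b + 1 : ℕ) : ℕ∞) := by push_cast; rfl
  rw [h1, h2, Nat.cast_le]
  omega

variable [Finite G]

/-- **The set `{u > 0 : G^u ≠ 1}` is the interval `(0, φ(b)]`** as soon as the lower
filtration satisfies `G_i ≠ 1 ↔ i ≤ b` for all `i ≥ 1` (any number of breaks below `b`):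
`G^u = G_{⌈ψ(u)⌉}` with `ψ = φ⁻¹` strictly increasing and `ψ(0) = 0`, so for `u > 0` the index
`⌈ψ(u)⌉ ≥ 1` is `≤ b` iff `ψ(u) ≤ b` iff `u ≤ φ(b)`.  Thus `φ(b)` is the largest upper
ramification break.  Serre, *Local Fields*, Ch. IV §3.
[cite: SerreLocalFields1979, Ch. IV §3 (upper numbering, pp. 73–74)] -/
theorem setOf_upperRamificationSubgroup_ne_bot_eq_Ioc_herbrandPhi {b : ℕ}
    (hlast : ∀ i, 1 ≤ i → (𝔓.ramificationSubgroup G i ≠ ⊥ ↔ i ≤ b)) :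
    {u : ℝ | 0 < u ∧ upperRamificationSubgroup 𝔓 G u ≠ ⊥} =
      Set.Ioc (0 : ℝ) (herbrandPhi 𝔓 G b) := by
  have hceil : ∀ {u : ℝ}, 0 < u → 1 ≤ ⌈herbrandPsi 𝔓 G u⌉₊ := by
    intro u hu
    have h0 : herbrandPsi 𝔓 G 0 = 0 := herbrandPsi_of_nonpos_holds 𝔓 G le_rfl
    have hψpos : 0 < herbrandPsi 𝔓 G u := by
      rw [← h0]
      exact herbrandPsi_strictMono 𝔓 G hu
    refine Nat.one_le_iff_ne_zero.mpr fun h => ?_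
    rw [Nat.ceil_eq_zero] at h
    exact absurd h (not_le.mpr hψpos)
  ext u
  simp only [Set.mem_setOf_eq, Set.mem_Ioc]
  constructor
  · rintro ⟨hu, hne⟩
    refine ⟨hu, ?_⟩
    have h : ⌈herbrandPsi 𝔓 G u⌉₊ ≤ b := (hlast _ (hceil hu)).mp hne
    have h' : herbrandPsi 𝔓 G u ≤ b := Nat.ceil_le.mp h
    exact (herbrandPsi_le_iff 𝔓 G).mp h'
  · rintro ⟨hu, hle⟩
    refine ⟨hu, ?_⟩
    have h' : herbrandPsi 𝔓 G u ≤ b := (herbrandPsi_le_iff 𝔓 G).mpr hle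
    exact (hlast _ (hceil hu)).mpr (Nat.ceil_le.mpr h')

/-- … so the Lebesgue measure of `{u > 0 : G^u ≠ 1}` is `φ(b)`, the largest upper break.
[cite: SerreLocalFields1979, Ch. IV §3 (upper numbering, pp. 73–74)] -/
theorem volume_real_setOf_upperRamificationSubgroup_ne_bot_eq_herbrandPhi {b : ℕ}
    (hlast : ∀ i, 1 ≤ i → (𝔓.ramificationSubgroup G i ≠ ⊥ ↔ i ≤ b)) :
    volume.real {u : ℝ | 0 < u ∧ upperRamificationSubgroup 𝔓 G u ≠ ⊥} = herbrandPhi 𝔓 G b := by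
  rw [setOf_upperRamificationSubgroup_ne_bot_eq_Ioc_herbrandPhi 𝔓 hlast,
    Real.volume_real_Ioc_of_le ((herbrandPhi_nonneg_iff 𝔓 G).mpr (Nat.cast_nonneg b)), sub_zero]

omit [Finite G] in
/-- If the non-trivial elements of the inertia group `G₀` are exactly the members of the finset
`T`, then `#G₀ = #T + 1`. [folklore] -/
theorem card_ramificationSubgroup_zero_eq_card_add_one (T : Finset G)
    (hT : ∀ s, s ∈ T ↔ s ∈ 𝔓.ramificationSubgroup G 0 ∧ s ≠ 1) :
    Nat.card (𝔓.ramificationSubgroup G 0) = T.card + 1 := by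
  classical
  have h1T : (1 : G) ∉ T := fun h => ((hT 1).mp h).2 rfl
  have hset : ((𝔓.ramificationSubgroup G 0 : Subgroup G) : Set G) = ↑(insert 1 T) := by
    ext s
    simp only [SetLike.mem_coe, Finset.coe_insert, Set.mem_insert_iff]
    constructor
    · intro hs
      by_cases hs1 : s = 1
      · exact Or.inl hs1
      · exact Or.inr ((hT s).mpr ⟨hs, hs1⟩)
    · rintro (rfl | hs)
      · exact Subgroup.one_mem _
      · exact ((hT s).mp hs).1
  rw [← SetLike.coe_sort_coe, hset, Finset.coe_sort_coe, Nat.card_eq_fintype_card,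
    Fintype.card_coe, Finset.card_insert_of_notMem h1T]

/-- **Serre's Lemma 3 evaluated.**  Let the non-trivial elements of `G₀` be the members of the
finset `T`, with indices `i_G(s) = f(s) ≤ b + 1` (`s ∈ T`).  Then
**`#G₀ · φ(b) = b + Σ_{s ∈ T} (f(s) - 1)`**: Lemma 3 at `u = b` reads
`#G₀ (φ(b) + 1) = Σ_{s ∈ G} inf(i_G(s), b + 1) = (b + 1) + Σ_{s ∈ T} f(s)` (the term `s = 1`
is `b + 1`, the terms `s ∉ G₀` vanish), and `#G₀ = #T + 1`.  Serre, *Local Fields*, Ch. IV §3,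
Lemma 3.  [cite: SerreLocalFields1979, Ch. IV §3 Lemma 3 (p. 74)] -/
theorem card_mul_herbrandPhi_eq_of_lowerIndex_eq {b : ℕ} (T : Finset G)
    (hT : ∀ s, s ∈ T ↔ s ∈ 𝔓.ramificationSubgroup G 0 ∧ s ≠ 1) (f : G → ℕ)
    (hf : ∀ s ∈ T, lowerIndex 𝔓 G s = f s) (hle : ∀ s ∈ T, f s ≤ b + 1) :
    (Nat.card (𝔓.ramificationSubgroup G 0) : ℝ) * herbrandPhi 𝔓 G b =
      b + ∑ s ∈ T, ((f s : ℝ) - 1) := by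
  classical
  have h1T : (1 : G) ∉ T := fun h => ((hT 1).mp h).2 rfl
  -- Lemma 3 at `b`
  obtain ⟨N, hN, hNreal⟩ := finsum_min_lowerIndex_eq_card_mul_herbrandPhi 𝔓 (G := G) b
  -- evaluate the finite sum
  have hsupp : (Function.support fun s : G => min (lowerIndex 𝔓 G s) ((b : ℕ∞) + 1)) ⊆
      ↑(insert 1 T) := by
    intro s hs
    rw [Function.mem_support] at hs
    rw [Finset.coe_insert, Set.mem_insert_iff, Finset.mem_coe]
    by_cases hs1 : s = 1
    · exact Or.inl hs1
    · refine Or.inr ((hT s).mpr ⟨?_, hs1⟩)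
      by_contra hs0
      apply hs
      rw [(lowerIndex_eq_zero_iff 𝔓).mpr hs0]
      simp
  have hsum : ∑ᶠ s : G, min (lowerIndex 𝔓 G s) ((b : ℕ∞) + 1) =
      ((b + 1 + ∑ s ∈ T, f s : ℕ) : ℕ∞) := by
    rw [finsum_eq_sum_of_support_subset _ hsupp, Finset.sum_insert h1T, lowerIndex_one,
      min_eq_right le_top]
    have hterm : ∀ s ∈ T, min (lowerIndex 𝔓 G s) ((b : ℕ∞) + 1) = (f s : ℕ∞) := by
      intro s hs
      rw [hf s hs, min_eq_left]
      exact_mod_cast hle s hs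
    rw [Finset.sum_congr rfl hterm]
    push_cast
    ring
  rw [hsum] at hN
  have hN' : b + 1 + ∑ s ∈ T, f s = N := by exact_mod_cast hN
  have hcard := card_ramificationSubgroup_zero_eq_card_add_one 𝔓 T hT
  have hreal : ((b + 1 + ∑ s ∈ T, f s : ℕ) : ℝ) =
      Nat.card (𝔓.ramificationSubgroup G 0) * (herbrandPhi 𝔓 G b + 1) := by
    rw [hN', hNreal]
  rw [hcard] at hreal ⊢
  rw [Finset.sum_sub_distrib, Finset.sum_const, nsmul_eq_mul, mul_one]
  push_cast at hreal ⊢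
  linarith

/-- **Serre's Lemma 3 evaluated on the wild elements only.**  Let the non-trivial elements of
`G₁` be the members of the finset `T₁`, with indices `i_G(s) = f(s) ≤ b + 1` (`s ∈ T₁`).  Then
**`#G₀ · φ(b) = b + Σ_{s ∈ T₁} (f(s) - 1)`**: the tamely ramified elements `s ∈ G₀ ∖ G₁` have
`i_G(s) = 1` and contribute nothing to `card_mul_herbrandPhi_eq_of_lowerIndex_eq`.
[cite: SerreLocalFields1979, Ch. IV §3 Lemma 3 (p. 74) and §1 (p. 62)] -/
theorem card_mul_herbrandPhi_eq_of_lowerIndex_eq_of_wild {b : ℕ} (T₁ : Finset G)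
    (hT₁ : ∀ s, s ∈ T₁ ↔ s ∈ 𝔓.ramificationSubgroup G 1 ∧ s ≠ 1) (f : G → ℕ)
    (hf : ∀ s ∈ T₁, lowerIndex 𝔓 G s = f s) (hle : ∀ s ∈ T₁, f s ≤ b + 1) :
    (Nat.card (𝔓.ramificationSubgroup G 0) : ℝ) * herbrandPhi 𝔓 G b =
      b + ∑ s ∈ T₁, ((f s : ℝ) - 1) := by
  classical
  haveI := Fintype.ofFinite G
  set T : Finset G :=
    Finset.univ.filter (fun s => s ∈ 𝔓.ramificationSubgroup G 0 ∧ s ≠ 1) with hTdef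
  have hT : ∀ s, s ∈ T ↔ s ∈ 𝔓.ramificationSubgroup G 0 ∧ s ≠ 1 := fun s => by
    simp [hTdef]
  set f' : G → ℕ := fun s => if s ∈ T₁ then f s else 1 with hf'def
  have hf' : ∀ s ∈ T, lowerIndex 𝔓 G s = f' s := by
    intro s hs
    by_cases h1 : s ∈ T₁
    · simp only [hf'def, h1, if_true, hf s h1]
    · have hs0 : s ∈ 𝔓.ramificationSubgroup G 0 := ((hT s).mp hs).1
      have hs1 : s ∉ 𝔓.ramificationSubgroup G 1 := fun h =>
        h1 ((hT₁ s).mpr ⟨h, ((hT s).mp hs).2⟩)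
      simp only [hf'def, h1, if_false, Nat.cast_one]
      refine le_antisymm ?_ ((one_le_lowerIndex_iff 𝔓).mpr hs0)
      exact_mod_cast (lowerIndex_le_natCast_iff 𝔓 (i := 1)).mpr hs1
  have hle' : ∀ s ∈ T, f' s ≤ b + 1 := by
    intro s _
    by_cases h1 : s ∈ T₁
    · simp only [hf'def, h1, if_true]; exact hle s h1
    · simp only [hf'def, h1, if_false]; omega
  rw [card_mul_herbrandPhi_eq_of_lowerIndex_eq 𝔓 T hT f' hf' hle']
  have hsub : T₁ ⊆ T := fun s hs => (hT s).mpr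
    ⟨𝔓.ramificationSubgroup_antitone G (Nat.zero_le 1) ((hT₁ s).mp hs).1, ((hT₁ s).mp hs).2⟩
  rw [← Finset.sum_subset hsub (fun s _ hs₁ => by simp [hf'def, hs₁])]
  congr 1
  exact Finset.sum_congr rfl fun s hs => by simp [hf'def, hs]

end LastGroup

/-! ### §2. The index of a wild element read on an element of order prime to `p` -/

section Index

variable {B : Type*} [CommRing B] [IsDedekindDomain B] {P : Ideal B} [P.IsMaximal]
  {G : Type*} [Group G] [MulSemiringAction G B]

omit [IsDedekindDomain B] [P.IsMaximal] in
/-- `σ ∈ G_j` and `y ∈ P^a` imply `σy - y ∈ P^{a+j}` (`σ` acts trivially on `P^a/P^{a+j}`;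
induction on `a`, `σ(y₁y₂) - y₁y₂ = (σy₁ - y₁)σy₂ + y₁(σy₂ - y₂)`).  Serre, *Local Fields*,
Ch. IV §2, proof of Prop. 7 ff. [cite: SerreLocalFields1979, Ch. IV §1 Lemma 1, §2 Prop. 7–9] -/
theorem smul_sub_mem_pow_add_of_mem_pow {j : ℕ} {σ : G} (hσ : σ ∈ P.ramificationSubgroup G j)
    {a : ℕ} {y : B} (hy : y ∈ P ^ a) : σ • y - y ∈ P ^ (a + j) := by
  induction a generalizing y with
  | zero =>
    rw [zero_add]
    exact Ideal.pow_le_pow_right (Nat.le_succ j) (hσ.2 y)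
  | succ a ih =>
    rw [pow_succ] at hy
    refine Submodule.mul_induction_on hy (fun y₁ hy₁ y₂ hy₂ => ?_) (fun x z hx hz => ?_)
    · have h1 : σ • (y₁ * y₂) - y₁ * y₂ = (σ • y₁ - y₁) * (σ • y₂) + y₁ * (σ • y₂ - y₂) := by
        rw [smul_mul']; ring
      rw [h1]
      refine Ideal.add_mem _ ?_ ?_
      · have hσy₂ : σ • y₂ ∈ P := by
          simpa using smul_mem_pow_of_smul_eq P hσ.1 (m := 1) (by simpa using hy₂)
        have : (σ • y₁ - y₁) * (σ • y₂) ∈ P ^ (a + j) * P := Ideal.mul_mem_mul (ih hy₁) hσy₂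
        rw [← pow_succ] at this
        simpa [show a + j + 1 = a + 1 + j by ring] using this
      · have : y₁ * (σ • y₂ - y₂) ∈ P ^ a * P ^ (j + 1) := Ideal.mul_mem_mul hy₁ (hσ.2 y₂)
        rw [← pow_add] at this
        simpa [show a + (j + 1) = a + 1 + j by ring] using this
    · have h1 : σ • (x + z) - (x + z) = (σ • x - x) + (σ • z - z) := by rw [smul_add]; ring
      rw [h1]
      exact Ideal.add_mem _ hx hz

variable [Finite (B ⧸ P)]

/-- **The index of a wild element on an element of order prime to `p`.**  Let `B` be a Dedekind
domain acted on by `G`, `P ≠ 0` a maximal ideal with finite residue field, `σ ∈ G₁` with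
`i_G(σ) = j + 1` (so `σ ∈ G_j ∖ G_{j+1}`, `j ≥ 1`), and `x ∈ B` with `v_P(x) = n` where `n` is
a unit of `B/P` (i.e. prime to the residue characteristic).  Then **`v_P(σx - x) = j + n`**.
Proof: with a uniformizer `π` (`v_P(σπ - π) = j + 1` by the uniformizer criterion) write
`x = πⁿd + c'`, `d ∉ P`, `c' ∈ Pⁿ⁺¹`; then
`σx - x = ((σπ)ⁿ - πⁿ)σd + πⁿ(σd - d) + (σc' - c')`, where the last two terms lie in `P^{n+j+1}`
(`smul_sub_mem_pow_add_of_mem_pow`) and `(σπ)ⁿ - πⁿ = (σπ - π) Σ_{k<n} (σπ)ᵏπⁿ⁻¹⁻ᵏ` with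
`Σ_{k<n} (σπ)ᵏπⁿ⁻¹⁻ᵏ ≡ nπⁿ⁻¹ (mod Pⁿ)` of order exactly `n - 1`.  (Serre's `i_G(s) = v_L(sπ - π)`
is the case `n = 1`.)  [cite: SerreLocalFields1979, Ch. IV §1 (pp. 61–63: i_G, Lemma 1) and §2 Prop. 5] -/
theorem ord_smul_sub_eq_of_lowerIndex_eq (hP : P ≠ ⊥) {σ : G}
    (hσ : σ ∈ P.ramificationSubgroup G 1) {j : ℕ} (hj : lowerIndex P G σ = j + 1)
    {x : B} {n : ℕ} (hx : ord P x = n) (hn : (n : B) ∉ P) :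
    ord P (σ • x - x) = ((j + n : ℕ) : ℕ∞) := by
  classical
  have hPtop : P ≠ ⊤ := Ideal.IsMaximal.ne_top inferInstance
  -- `σ ∈ G_j ∖ G_{j+1}`, `j ≥ 1`, `σ ∈ G_0`
  have hσj : σ ∈ P.ramificationSubgroup G j := (add_one_le_lowerIndex_iff P).mp (hj ▸ le_rfl)
  have hσj1 : σ ∉ P.ramificationSubgroup G (j + 1) := by
    intro h
    have h' := add_one_le_lowerIndex P h
    rw [hj] at h'
    have : ((j + 1 + 1 : ℕ) : ℕ∞) ≤ ((j + 1 : ℕ) : ℕ∞) := by push_cast at h' ⊢; exact h'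
    exact absurd (Nat.cast_le.mp this) (by omega)
  have hj1 : 1 ≤ j := by
    have h' := add_one_le_lowerIndex P hσ
    rw [hj] at h'
    have : ((1 + 1 : ℕ) : ℕ∞) ≤ ((j + 1 : ℕ) : ℕ∞) := by push_cast at h' ⊢; exact h'
    have := Nat.cast_le.mp this
    omega
  have hσ0 : σ ∈ P.ramificationSubgroup G 0 := P.ramificationSubgroup_antitone G (Nat.zero_le 1) hσ
  have hσP : σ • P = P := hσ.1
  -- `n ≥ 1`
  have hn0 : n ≠ 0 := by rintro rfl; exact hn (by simp)
  -- a uniformizer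
  obtain ⟨ϖ, hϖ, hϖ2⟩ := Ideal.exists_mem_pow_notMem_pow_succ P hP hPtop 1
  rw [pow_one] at hϖ
  have hordϖ : ord P ϖ = 1 := ord_eq_one P hϖ hϖ2
  -- `v(σϖ - ϖ) = j + 1`
  have hδmem : σ • ϖ - ϖ ∈ P ^ (j + 1) :=
    (mem_ramificationSubgroup_iff_smul_sub_mem hP hϖ hϖ2 hσ0 j).mp hσj
  have hδnot : σ • ϖ - ϖ ∉ P ^ (j + 2) := fun h =>
    hσj1 ((mem_ramificationSubgroup_iff_smul_sub_mem hP hϖ hϖ2 hσ0 (j + 1)).mpr h)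
  have hordδ : ord P (σ • ϖ - ϖ) = ((j + 1 : ℕ) : ℕ∞) := by
    refine le_antisymm ?_ ((mem_pow_iff_le_ord P).mp hδmem)
    by_contra hlt
    push Not at hlt
    apply hδnot
    rw [mem_pow_iff_le_ord]
    have : ((j + 1 : ℕ) : ℕ∞) + 1 ≤ ord P (σ • ϖ - ϖ) := Order.add_one_le_of_lt hlt
    push_cast at this ⊢
    exact this
  -- expansion `x = ϖⁿ d + c'`
  have hxn : x ∈ P ^ n := (mem_pow_iff_le_ord P).mpr hx.ge
  obtain ⟨d, c', hc', hxeq⟩ := exists_eq_pow_mul_add_of_mem_pow P hP hϖ hϖ2 hxn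
  have hd : d ∉ P := by
    intro hd
    have hmem : x ∈ P ^ (n + 1) := by
      rw [hxeq, pow_succ]
      exact Ideal.add_mem _ (Ideal.mul_mem_mul (Ideal.pow_mem_pow hϖ n) hd) hc'
    have := (mem_pow_iff_le_ord P).mp hmem
    rw [hx] at this
    have h' : n + 1 ≤ n := by exact_mod_cast this
    omega
  have hσd : σ • d ∉ P := fun h => hd (by
    simpa using (smul_mem_pow_iff_of_smul_eq P hσP (m := 1)).mp (by simpa using h))
  -- the cofactor `Σ_{k<n} (σϖ)ᵏ ϖⁿ⁻¹⁻ᵏ ≡ n ϖⁿ⁻¹ (mod Pⁿ)`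
  set C : B := ∑ k ∈ Finset.range n, (σ • ϖ) ^ k * ϖ ^ (n - 1 - k) with hC
  have hgeom : C * (σ • ϖ - ϖ) = (σ • ϖ) ^ n - ϖ ^ n := by
    rw [hC]
    exact (Commute.all _ _).geom_sum₂_mul n
  have hσϖP : σ • ϖ ∈ P := by
    simpa using smul_mem_pow_of_smul_eq P hσP (m := 1) (by simpa using hϖ)
  have hCsub : C - (n : B) * ϖ ^ (n - 1) ∈ P ^ n := by
    have hterm : ∀ k ∈ Finset.range n,
        (σ • ϖ) ^ k * ϖ ^ (n - 1 - k) - ϖ ^ (n - 1) ∈ P ^ n := by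
      intro k hk
      have hk' : k < n := Finset.mem_range.mp hk
      -- `(σϖ)ᵏ - ϖᵏ = (Σ_{i<k} (σϖ)ⁱ ϖᵏ⁻¹⁻ⁱ)(σϖ - ϖ) ∈ P^{k-1} · P² ⊆ P^{k+1}`
      have hpow : (σ • ϖ) ^ k - ϖ ^ k ∈ P ^ (k + 1) := by
        rcases Nat.eq_zero_or_pos k with rfl | hkpos
        · simp
        · have hg : (∑ i ∈ Finset.range k, (σ • ϖ) ^ i * ϖ ^ (k - 1 - i)) * (σ • ϖ - ϖ) =
              (σ • ϖ) ^ k - ϖ ^ k := (Commute.all _ _).geom_sum₂_mul k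
          rw [← hg, show k + 1 = (k - 1) + 2 by omega, pow_add]
          refine Ideal.mul_mem_mul (Ideal.sum_mem _ fun i hi => ?_) ?_
          · have hi' : i < k := Finset.mem_range.mp hi
            have h1 : (σ • ϖ) ^ i ∈ P ^ i := Ideal.pow_mem_pow hσϖP i
            have h2 : ϖ ^ (k - 1 - i) ∈ P ^ (k - 1 - i) := Ideal.pow_mem_pow hϖ _
            have := Ideal.mul_mem_mul h1 h2
            rwa [← pow_add, show i + (k - 1 - i) = k - 1 by omega] at this
          · exact Ideal.pow_le_pow_right (by omega) hδmem
      have hsplit : (σ • ϖ) ^ k * ϖ ^ (n - 1 - k) - ϖ ^ (n - 1) =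
          ((σ • ϖ) ^ k - ϖ ^ k) * ϖ ^ (n - 1 - k) := by
        rw [sub_mul, ← pow_add, show k + (n - 1 - k) = n - 1 by omega]
      rw [hsplit]
      have := Ideal.mul_mem_mul hpow (Ideal.pow_mem_pow hϖ (n - 1 - k))
      rwa [← pow_add, show k + 1 + (n - 1 - k) = n by omega] at this
    have hsum := Ideal.sum_mem (P ^ n) hterm
    rw [Finset.sum_sub_distrib, Finset.sum_const, Finset.card_range, nsmul_eq_mul] at hsum
    rwa [hC]
  have hordnϖ : ord P ((n : B) * ϖ ^ (n - 1)) = ((n - 1 : ℕ) : ℕ∞) := by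
    rw [ord_mul P hP, ord_pow P hP, hordϖ, (ord_eq_zero_iff P).mpr hn, mul_one, zero_add]
  have hordC : ord P C = ((n - 1 : ℕ) : ℕ∞) := by
    have hlt : ord P ((n : B) * ϖ ^ (n - 1)) < ord P (C - (n : B) * ϖ ^ (n - 1)) := by
      rw [hordnϖ]
      refine lt_of_lt_of_le ?_ ((mem_pow_iff_le_ord P).mp hCsub)
      exact_mod_cast (by omega : n - 1 < n)
    have := ord_add_eq_of_lt P hlt
    rwa [sub_add_cancel, hordnϖ] at this
  -- the three terms
  set T₁ : B := ((σ • ϖ) ^ n - ϖ ^ n) * (σ • d) with hT₁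
  set T₂ : B := ϖ ^ n * (σ • d - d) + (σ • c' - c') with hT₂
  have hdecomp : σ • x - x = T₂ + T₁ := by
    rw [hxeq, smul_add, smul_mul', smul_pow', hT₁, hT₂]
    ring
  have hordT₁ : ord P T₁ = ((j + n : ℕ) : ℕ∞) := by
    rw [hT₁, ← hgeom, ord_mul P hP, ord_mul P hP, hordC, hordδ, (ord_eq_zero_iff P).mpr hσd,
      add_zero]
    push_cast
    have : ((n - 1 : ℕ) : ℕ∞) + ((j : ℕ∞) + 1) = (j : ℕ∞) + n := by
      have h := (Nat.sub_add_cancel (Nat.one_le_iff_ne_zero.mpr hn0))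
      calc ((n - 1 : ℕ) : ℕ∞) + ((j : ℕ∞) + 1) = ((n - 1 + 1 : ℕ) : ℕ∞) + j := by push_cast; ring
        _ = (j : ℕ∞) + n := by rw [h, add_comm]
    exact this
  have hT₂mem : T₂ ∈ P ^ (j + n + 1) := by
    rw [hT₂]
    refine Ideal.add_mem _ ?_ ?_
    · have := Ideal.mul_mem_mul (Ideal.pow_mem_pow hϖ n) (hσj.2 d)
      rwa [← pow_add, show n + (j + 1) = j + n + 1 by ring] at this
    · have := smul_sub_mem_pow_add_of_mem_pow hσj hc'
      rwa [show n + 1 + j = j + n + 1 by ring] at this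
  have hlt : ord P T₁ < ord P T₂ := by
    rw [hordT₁]
    refine lt_of_lt_of_le ?_ ((mem_pow_iff_le_ord P).mp hT₂mem)
    exact_mod_cast Nat.lt_succ_self _
  rw [hdecomp, ord_add_eq_of_lt P hlt, hordT₁]

/-- **The index of an element acting as `-1`.**  In the setting of
`ord_smul_sub_eq_of_lowerIndex_eq`, let `σ ∈ G₁` with `i_G(σ) = j + 1` act on `w ∈ B` by
`σw = -w` and fix `t ∈ B`, and suppose `v_P(w - t) = n` is a unit mod `P` (in residue
characteristic `2`: `n` odd).  Then **`v_P(2w) = j + n`** (`σ(w - t) - (w - t) = -2w`).  For the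
quadratic extension `M(w)/M` (`w² ∈ M`, `σ` its involution) this is the break
`b = i(σ) - 1 = v(2w) - v(w - t)` read off an approximate square root `t ∈ M` of `w²`
(cf. `ord_two_mul_root_add_eq`, the Eisenstein normal form `t = -c₁/2`).
[cite: SerreLocalFields1979, Ch. IV §1 (i_G) and §2 Prop. 5; cf. Ch. IV §3 Ex. 3 (quadratic extensions)] -/
theorem ord_two_mul_eq_of_smul_eq_neg (hP : P ≠ ⊥) {σ : G}
    (hσ : σ ∈ P.ramificationSubgroup G 1) {j : ℕ} (hj : lowerIndex P G σ = j + 1)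
    {w t : B} (hw : σ • w = -w) (ht : σ • t = t) {n : ℕ} (hx : ord P (w - t) = n)
    (hn : (n : B) ∉ P) : ord P (2 * w) = ((j + n : ℕ) : ℕ∞) := by
  have h := ord_smul_sub_eq_of_lowerIndex_eq hP hσ hj hx hn
  have h1 : σ • (w - t) - (w - t) = -(2 * w) := by rw [smul_sub, hw, ht]; ring
  rwa [h1, ord_neg] at h

/-- **`i_G(σ) = v_P(2w) - v_P(w - t) + 1`**, solved form of `ord_two_mul_eq_of_smul_eq_neg`: for
`σ ∈ G₁` with `σw = -w`, `σt = t`, `v_P(2w) = m` and `v_P(w - t) = n` a unit mod `P`, one has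
`n ≤ m` and `i_G(σ) = (m - n) + 1`.  (`i_G(σ)` is finite: were `σ ∈ G_i` for all `i`, then
`2w = -(σ(w - t) - (w - t)) ∈ ⋂ Pⁱ = 0`, contradicting `v_P(2w) = m < ∞`.)
[cite: SerreLocalFields1979, Ch. IV §1 (i_G) and §2 Prop. 5] -/
theorem lowerIndex_eq_of_smul_eq_neg (hP : P ≠ ⊥) {σ : G}
    (hσ : σ ∈ P.ramificationSubgroup G 1) {w t : B} (hw : σ • w = -w) (ht : σ • t = t)
    {m n : ℕ} (h2w : ord P (2 * w) = m) (hx : ord P (w - t) = n) (hn : (n : B) ∉ P) :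
    n ≤ m ∧ lowerIndex P G σ = ((m - n : ℕ) : ℕ∞) + 1 := by
  -- `i_G(σ)` is finite
  have h1 : σ • (w - t) - (w - t) = -(2 * w) := by rw [smul_sub, hw, ht]; ring
  have hfin : lowerIndex P G σ ≠ ⊤ := by
    intro htop
    have hall := (lowerIndex_eq_top_iff P).mp htop
    have hmem : ∀ i : ℕ, 2 * w ∈ P ^ i := fun i => by
      have := (hall i).2 (w - t)
      rw [h1] at this
      simpa using Ideal.pow_le_pow_right (Nat.le_succ i) (neg_mem_iff.mp this)
    have hle : ∀ i : ℕ, (i : ℕ∞) ≤ ord P (2 * w) := fun i => (mem_pow_iff_le_ord P).mp (hmem i)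
    have := hle (m + 1)
    rw [h2w] at this
    exact absurd (Nat.cast_le.mp this) (by omega)
  obtain ⟨k, hk⟩ := ENat.ne_top_iff_exists.mp hfin
  -- `k = j + 1` with `j ≥ 1`
  have hk2 : 2 ≤ k := by
    have h' := add_one_le_lowerIndex P hσ
    rw [← hk] at h'
    have : ((1 + 1 : ℕ) : ℕ∞) ≤ (k : ℕ∞) := by push_cast at h' ⊢; exact h'
    have := Nat.cast_le.mp this
    omega
  obtain ⟨j, rfl⟩ : ∃ j, k = j + 1 := ⟨k - 1, by omega⟩
  have hj : lowerIndex P G σ = j + 1 := by rw [← hk]; push_cast; rfl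
  have h := ord_two_mul_eq_of_smul_eq_neg hP hσ hj hw ht hx hn
  rw [h2w] at h
  have hm : m = j + n := Nat.cast_injective (R := ℕ∞) h
  refine ⟨by omega, ?_⟩
  rw [hj, show m - n = j by omega]

end Index

end Literature.NumberTheory.GaloisRepresentations

end
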